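/-
Copyright (c) 2026 the pub-hodgecm-mathlib formalisation cell (harness21).  Prover seat hodgecm-mathlib-LH3-p04 (g4): line LH3 (closer stub `stub_N9`), leaf v5 organ O-L1e
(X′-corners), brick **(X2) TWO-BLOCK DESCENT BOX** (LH3-plan (g4) RULING #18 deal 2026-09-02T10:55:54Z).
-/
import Literature.NumberTheory.Rogawski1990.ArchOrbFamGExtBoxDescent                  -- ★ p851016 (this seat): (B-desc) box edition; brings the whole one-place tool chain
import Literature.NumberTheory.Automorphic.ArchInnerFormTwoWallCentralizerBlock        -- ★ p851215 (this seat) (X2-M): `exists_continuousMulEquiv_centralizer_gprimeTorus_twoWall_explicit`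
import Literature.NumberTheory.Rogawski1990.ArchInnerFormSplitPlaceProper              -- ★ `uniformlyProper_gprimeBlock_split_of_ne_zero`, `uniformlyProper_arch_of_places` chain
import Literature.NumberTheory.Rogawski1990.ArchInnerFormSemiregularProper             -- ★ `uniformlyProper_gprimeBlock_cpt_of_ne`, `…_of_injective`, `stabilizer_single_le_centralizer_gprimeBlock_of_wall`
import HarnessLib

/-!
# (X2) TWO-BLOCK DESCENT BOX: the descent identity of the genuine `G′`-family near a point with non-compact-wall coincidences at TWO places
# — `chartOrbG(c) = K · ∫_{U(J) × U(J)} f(c, h₁ · P diag(e^{ic_{w₁0}}, e^{ic_{w₁2}}) P⁻¹ · h₁⁻¹, h₂ · P diag(e^{ic_{w₂0}}, e^{ic_{w₂2}}) P⁻¹ · h₂⁻¹) d(μ₀ ⊗ μ₀)`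
# (Rogawski 1990 §4.12 Lemma 4.12.1, §8.2 pp. 119–124; Harish-Chandra–van Dijk 1970 I §3; Shelstad 1979 §4)

Topic `NumberTheory/Rogawski1990`; namespace `Literature.NumberTheory.Rogawski1990`.  THEOREMS ONLY (no `def`, no instance, no notation, no axiom, no named fact, no `sorry`);
kernel lane `--kind proof --supports stmt-HodgeConjecture-24833`.  Cell `pub/hodgecm-mathlib`, crux H413 (`stmt-HodgeConjecture-24833`), F0∕P3c line LH3 (closer stub `stub_N9`),
leaf v5 organ **O-L1e «X′-CORNERS»** (RULING #18: every coincidence place one-wall, ≥ 2 places), in-house road (X1) F0P3a-p02 (g21) ∕ **(X2) = this file** ∕ (X3) F0P3a-p02 +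
F0P3a-p04; the cross-place twin of ★ p851016 `ArchOrbFamGExtBoxDescent` (one place).  Author LH3-p04 (g4).

THE MATHEMATICS.  Same descent as ★ p851016 at the ONE group element `γ_p = gprimeTorus α S p`, now with walls `e^{ip_{w,0}} = e^{ip_{w,2}} ≠ e^{ip_{w,1}}` at TWO covered
places `w₁ ≠ w₂ ∉ S` (regular elsewhere, `x_w ≠ 0` on `S`): §1 Harish-Chandra's compactness ★ D4b-1 on a compact BOX around `p` — assembled PLACE BY PLACE exactly as ★ p850367
`uniformlyProper_gprimeTorus_of_semireg` (★ `uniformlyProper_arch_of_places`: the two wall places by ★ `uniformlyProper_gprimeBlock_cpt_of_ne` + ★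
`stabilizer_single_le_centralizer_gprimeBlock_of_wall`, the other compact places by ★ `…_of_injective`, the split places by ★ `uniformlyProper_gprimeBlock_split_of_ne_zero`);
§2 the (X2-M) splitting ★ p851215 `Z(γ_p) ≃ₜ* (B₁ × B₂) × K` standardised blockwise to `U(J) × U(J)` (★ (B-STD) `exists_continuousMulEquiv_prod_std` at `w₁` and at `w₂`),
the block torus `A = φ₁(A₁) × φ₂(A₂)` (compact, commutative), `Ψ : Z(γ_p) ⧸ T′ ≃ₜ (U(J) × U(J)) ⧸ A` (★ `exists_quotient_homeomorph_of_map_eq_prod_top`), the descent scalar `κ` against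
the PRODUCT Haar measure `μ₀ ⊗ μ₀` (★ `exists_smul_map_mk_of_block_compact`), ONE cut-off `β`, and the smooth ambient reading
`f(c, X, Y) = χ(X, Y) · ΘM(Λ₁(M₁⁻¹ X M₁) · Λ₂(M₂⁻¹ Y M₂) · ↑↑γ_S(update (update c w₁ (0,c_{w₁1},0)) w₂ (0,c_{w₂1},0)))` (★ (aM-SMOOTH), ★ (eM-SMOOTH) at both places, clauses
[8]₁ [8]₂ [10] of (X2-M), the frame matrices `M_i` of `φ_i`).  ★ D4b and ★ p850417 §1 `integral_descConj_eq_smul_integral_of_block` (generic block group) give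
  **`chartOrbG L α ν′ S a′ c = (dt′(B′)·κ) · ∫_{U(J) × U(J)} f(c, ↑↑(q₁ · P t_{c,w₁} P⁻¹ · q₁⁻¹), ↑↑(q₂ · P t_{c,w₂} P⁻¹ · q₂⁻¹)) d(μ₀ ⊗ μ₀)(q)`  for all `c ∈ U ∩ RegG S`**,
`f` jointly `C^∞`, compactly supported in `(X, Y)` uniformly in `c`, depending on `c` only through the double tangential point.
HONEST LABEL: HC_CM is proved only modulo the 7 printed citations (2 remaining: hLiu418 = `stmt-HodgeConjecture-24832`, h413 = `stmt-HodgeConjecture-24833`) until rung 0 closes;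
count-neutral assembly of ★ bricks.

## References
* [Rogawski1990] J. D. Rogawski, *Automorphic Representations of Unitary Groups in Three Variables*, Ann. of Math. Stud. 123 (1990), §4.12 Lemma 4.12.1 p. 66, §8.2 pp. 119–124.
* [HarishChandra1970] Harish-Chandra (notes by G. van Dijk), *Harmonic Analysis on Reductive p-adic Groups*, LNM 162 (1970), Part I §3 Lemmas 22–23.
* [Shelstad1979] D. Shelstad, *Characters and inner forms of a quasi-split group over ℝ*, Compositio Math. 39 (1979), §4 pp. 22–25.
* [Folland1995] G. B. Folland, *A Course in Abstract Harmonic Analysis* (1995), §2.6 Thm. 2.49, (2.52).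
-/

set_option autoImplicit false

noncomputable section

open MeasureTheory MeasureTheory.Measure NumberField NumberField.InfinitePlace NumberField.mixedEmbedding Matrix Complex Set Filter Topology
open scoped MatrixGroups Matrix Real Classical ENNReal NNReal ContDiff Matrix.Norms.Operator Pointwise
open Literature.NumberTheory.Automorphic Literature.NumberTheory.Automorphic.UnitaryGroup Literature.NumberTheory.Automorphic.ArchCartan
open Literature.NumberTheory.GaloisRepresentations Literature.MeasureTheory.Group

namespace Literature.NumberTheory.Rogawski1990

/-! ## §1 Harish-Chandra's compactness on a BOX around a two-wall point -/

section BoxOpen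

variable {W : Type*} [Fintype W] (S : Finset W) (w₁ w₂ : W)

/-- The two-wall box is OPEN: at `w₁`, `w₂` the middle unit eigenvalue stays simple, at the other compact places the three unit eigenvalues stay distinct, at the split places
`x_w ≠ 0`. [cite: Rogawski1990, §8.2 p. 118] [cite: Shelstad1979, §4 p. 22] -/
theorem isOpen_pi_twoWallBox :
    IsOpen (Set.pi Set.univ (fun w : W => {cw : Fin 3 → ℝ |
        ((w = w₁ ∨ w = w₂) → ∀ j : Fin 3, j ≠ 1 → Circle.exp (cw 1) ≠ Circle.exp (cw j)) ∧
        (w ∉ S → w ≠ w₁ → w ≠ w₂ → Function.Injective fun l : Fin 3 => Circle.exp (cw l)) ∧ (w ∈ S → cw 0 ≠ 0)})) := by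
  have himp : ∀ (P : Prop) (Q : (Fin 3 → ℝ) → Prop), IsOpen {cw | Q cw} → IsOpen {cw | P → Q cw} := fun P Q hQ => by
    by_cases hP : P
    · have h : {cw : Fin 3 → ℝ | P → Q cw} = {cw | Q cw} := Set.ext fun cw => ⟨fun h => h hP, fun h _ => h⟩
      rw [h]; exact hQ
    · have h : {cw : Fin 3 → ℝ | P → Q cw} = Set.univ := Set.eq_univ_of_forall fun cw h => absurd h hP
      rw [h]; exact isOpen_univ
  refine isOpen_set_pi Set.finite_univ fun w _ => ?_
  refine (himp _ _ ?_).and ((himp _ _ (himp _ _ (himp _ _ ?_))).and (himp _ _ (isOpen_ne_fun (continuous_apply 0) continuous_const)))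
  · have h : {cw : Fin 3 → ℝ | ∀ j : Fin 3, j ≠ 1 → Circle.exp (cw 1) ≠ Circle.exp (cw j)} =
        {cw | Circle.exp (cw 1) ≠ Circle.exp (cw 0)} ∩ {cw | Circle.exp (cw 1) ≠ Circle.exp (cw 2)} := by
      ext cw
      simp only [Set.mem_setOf_eq, Set.mem_inter_iff]
      constructor
      · intro h; exact ⟨h 0 (by decide), h 2 (by decide)⟩
      · rintro ⟨h0, h2⟩ j hj
        fin_cases j
        · exact h0
        · exact absurd rfl hj
        · exact h2
    rw [h]
    exact (isOpen_ne_fun (Circle.exp.continuous.comp (continuous_apply 1)) (Circle.exp.continuous.comp (continuous_apply 0))).inter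
      (isOpen_ne_fun (Circle.exp.continuous.comp (continuous_apply 1)) (Circle.exp.continuous.comp (continuous_apply 2)))
  · have h : {cw : Fin 3 → ℝ | Function.Injective fun l : Fin 3 => Circle.exp (cw l)} =
        ⋂ q ∈ {q : Fin 3 × Fin 3 | q.1 ≠ q.2}, {cw : Fin 3 → ℝ | Circle.exp (cw q.1) ≠ Circle.exp (cw q.2)} := by
      ext cw
      simp only [Set.mem_setOf_eq, Set.mem_iInter, Prod.forall]
      constructor
      · intro hc i j hij h
        exact hij (hc h)
      · intro hc i j h
        by_contra hij
        exact hc i j hij h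
    rw [h]
    exact Set.Finite.isOpen_biInter (Set.toFinite _) fun q _ =>
      isOpen_ne_fun (Circle.exp.continuous.comp (continuous_apply q.1)) (Circle.exp.continuous.comp (continuous_apply q.2))

end BoxOpen

section Box

variable (L : Type) [Field L] [NumberField L] [IsCMField L] (α : Fin 3 → L)
  (S : Finset {w : InfinitePlace L // IsComplex w}) (w₁ w₂ : {w : InfinitePlace L // IsComplex w}) (p : {w : InfinitePlace L // IsComplex w} → Fin 3 → ℝ)

/-- **★ D4b-1 at a TWO-WALL point, place by place** (the two-place twin of ★ `uniformlyProper_gprimeTorus_of_semireg_of_regular`): `p` has walls with simple slot `1` at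
`w₁`, `w₂` (compact-chart places); uniform properness modulo `Z(γ_p)` for chart points in a compact set of the box (slot `1` simple at `w₁`, `w₂`; distinct unit eigenvalues at
the other compact places; `x ≠ 0` at the split places). [cite: Rogawski1990, §4.12 Lemma 4.12.1 p. 66; §8.2 p. 122] [cite: HarishChandra1970, Part I §3 Lemma 22] -/
theorem uniformlyProper_gprimeTorus_of_twoWall (hα : ∀ i, α i ≠ 0)
    (hreal : ∀ (w : {w : InfinitePlace L // IsComplex w}) (i : Fin 3), (w.1.embedding (α i)).im = 0)
    (hw₁ : ¬ (w₁ ∈ S ∧ w₁ ∈ splitChartPlaces L α)) (hw₂ : ¬ (w₂ ∈ S ∧ w₂ ∈ splitChartPlaces L α))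
    (hwall₁ : ∀ j j' : Fin 3, j ≠ 1 → j' ≠ 1 → Circle.exp (p w₁ j) = Circle.exp (p w₁ j'))
    (hwall₂ : ∀ j j' : Fin 3, j ≠ 1 → j' ≠ 1 → Circle.exp (p w₂ j) = Circle.exp (p w₂ j'))
    (hp : ∀ w, w ∈ S ∧ w ∈ splitChartPlaces L α → p w 0 ≠ 0)
    (B : {w : InfinitePlace L // IsComplex w} → Set (Fin 3 → ℝ))
    (hB₁ : B w₁ ⊆ {cw : Fin 3 → ℝ | ∀ j, j ≠ 1 → Circle.exp (cw 1) ≠ Circle.exp (cw j)})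
    (hB₂ : B w₂ ⊆ {cw : Fin 3 → ℝ | ∀ j, j ≠ 1 → Circle.exp (cw 1) ≠ Circle.exp (cw j)})
    (hBcpt : ∀ w, w ≠ w₁ → w ≠ w₂ → ¬ (w ∈ S ∧ w ∈ splitChartPlaces L α) → B w ⊆ {cw : Fin 3 → ℝ | Function.Injective fun i : Fin 3 => Circle.exp (cw i)})
    (hBsplit : ∀ w, w ∈ S ∧ w ∈ splitChartPlaces L α → B w ⊆ {cw : Fin 3 → ℝ | cw 0 ≠ 0}) :
    ∀ K ⊆ Set.pi Set.univ B, IsCompact K → ∀ C' : Set ↥(arch (↥(maximalRealSubfield L)) L (IsCMField.complexConj L) 3 (Matrix.diagonal α)), IsCompact C' →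
      ∃ 𝒦' : Set (↥(arch (↥(maximalRealSubfield L)) L (IsCMField.complexConj L) 3 (Matrix.diagonal α)) ⧸ Subgroup.centralizer ({gprimeTorus L α S p} : Set ↥(arch (↥(maximalRealSubfield L)) L (IsCMField.complexConj L) 3 (Matrix.diagonal α)))),
        IsCompact 𝒦' ∧ ∀ c ∈ K, ∀ y' : ↥(arch (↥(maximalRealSubfield L)) L (IsCMField.complexConj L) 3 (Matrix.diagonal α)), y' * gprimeTorus L α S c * y'⁻¹ ∈ C' →
          (QuotientGroup.mk y' : ↥(arch (↥(maximalRealSubfield L)) L (IsCMField.complexConj L) 3 (Matrix.diagonal α)) ⧸ Subgroup.centralizer ({gprimeTorus L α S p} : Set ↥(arch (↥(maximalRealSubfield L)) L (IsCMField.complexConj L) 3 (Matrix.diagonal α)))) ∈ 𝒦' := by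
  -- adapted from ★ `uniformlyProper_gprimeTorus_of_semireg` (LH3-p02 (g3)): one more wall place in the case split
  have hMM' : ∀ g : ∀ w : {w : InfinitePlace L // IsComplex w}, ↥(archLocal L 3 (Matrix.diagonal α) w),
      (archPiEquivCM 3 L (Matrix.diagonal α)).symm g ∈ Subgroup.centralizer ({gprimeTorus L α S p} : Set ↥(arch (↥(maximalRealSubfield L)) L (IsCMField.complexConj L) 3 (Matrix.diagonal α))) ↔
        g ∈ Subgroup.pi Set.univ fun w => Subgroup.centralizer ({gprimeBlock L α w S p} : Set ↥(archLocal L 3 (Matrix.diagonal α) w)) :=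
    fun g => by
      rw [gprimeTorus, show ((archPiEquivCM 3 L (Matrix.diagonal α)).symm g) = (archPiEquivCM 3 L (Matrix.diagonal α)).symm.toMulEquiv g from rfl,
        show ((archPiEquivCM 3 L (Matrix.diagonal α)).symm fun w => gprimeBlock L α w S p) =
          (archPiEquivCM 3 L (Matrix.diagonal α)).symm.toMulEquiv (fun w => gprimeBlock L α w S p) from rfl,
        mulEquiv_apply_mem_centralizer_singleton_iff, Subgroup.mem_centralizer_singleton_iff, Subgroup.mem_pi]
      simp only [Set.mem_univ, true_imp_iff, Subgroup.mem_centralizer_singleton_iff]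
      exact ⟨fun h w => congrFun h w, fun h => funext h⟩
  have hprop : ∀ w : {w : InfinitePlace L // IsComplex w}, ∀ K ⊆ B w, IsCompact K → ∀ C : Set ↥(archLocal L 3 (Matrix.diagonal α) w), IsCompact C →
      ∃ 𝒦 : Set (↥(archLocal L 3 (Matrix.diagonal α) w) ⧸ Subgroup.centralizer ({gprimeBlock L α w S p} : Set ↥(archLocal L 3 (Matrix.diagonal α) w))),
        IsCompact 𝒦 ∧ ∀ cw ∈ K, ∀ y : ↥(archLocal L 3 (Matrix.diagonal α) w), y * gprimeBlock L α w S (fun _ => cw) * y⁻¹ ∈ C →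
          (QuotientGroup.mk y : ↥(archLocal L 3 (Matrix.diagonal α) w) ⧸ Subgroup.centralizer ({gprimeBlock L α w S p} : Set ↥(archLocal L 3 (Matrix.diagonal α) w))) ∈ 𝒦 := by
    intro w
    by_cases hws : w ∈ S ∧ w ∈ splitChartPlaces L α
    · exact uniformlyProper_mono _ _ (hBsplit w hws) (uniformlyProper_gprimeBlock_split_of_ne_zero L α S hα hws.1 hws.2 p (hp w hws))
    · by_cases hw1 : w = w₁
      · subst hw1
        exact uniformlyProper_mono _ _ hB₁ (uniformlyProper_gprimeBlock_cpt_of_ne L α S hα (hreal w) hws 1 _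
          (stabilizer_single_le_centralizer_gprimeBlock_of_wall L α S hα (hreal w) hws 1 p hwall₁))
      · by_cases hw2 : w = w₂
        · subst hw2
          exact uniformlyProper_mono _ _ hB₂ (uniformlyProper_gprimeBlock_cpt_of_ne L α S hα (hreal w) hws 1 _
            (stabilizer_single_le_centralizer_gprimeBlock_of_wall L α S hα (hreal w) hws 1 p hwall₂))
        · exact uniformlyProper_mono _ _ (hBcpt w hw1 hw2 hws) (uniformlyProper_gprimeBlock_cpt_of_injective L α S hα hws _)
  exact uniformlyProper_arch_of_places L 3 (Matrix.diagonal α) (fun w => Subgroup.centralizer ({gprimeBlock L α w S p} : Set ↥(archLocal L 3 (Matrix.diagonal α) w)))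
    (Subgroup.centralizer ({gprimeTorus L α S p} : Set _)) hMM' (fun w cw => gprimeBlock L α w S (fun _ => cw)) B hprop

/-- **ONE COMPACT `C″` FOR ALL CHART POINTS NEAR A TWO-WALL POINT** (Rogawski's Lemma 4.12.1 «for all `x` in a neighbourhood of `1` in `M`», two-place box): a compact `C″ ⊆ G′_∞`
and an open `U ∋ p` inside the two-wall box such that for EVERY `c ∈ U`: `y′ · gprimeTorus c · y′⁻¹ ∈ C′ ⇒ y′ ∈ C″ · Z(gprimeTorus p)`.
[cite: Rogawski1990, §4.12 Lemma 4.12.1 p. 66; §8.2 p. 122] [cite: HarishChandra1970, Part I §3 Lemma 22] [cite: Shelstad1979, §4 pp. 22–25] -/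
theorem exists_isCompact_mul_centralizer_box_twoWall (hα : ∀ i, α i ≠ 0)
    (hreal : ∀ (w : {w : InfinitePlace L // IsComplex w}) (i : Fin 3), (w.1.embedding (α i)).im = 0)
    (hS : ∀ w, w ∈ S → w ∈ splitChartPlaces L α) (hw₁ : w₁ ∉ S) (hw₂ : w₂ ∉ S)
    (h02₁ : p w₁ 0 = p w₁ 2) (h01₁ : Circle.exp (p w₁ 0) ≠ Circle.exp (p w₁ 1))
    (h02₂ : p w₂ 0 = p w₂ 2) (h01₂ : Circle.exp (p w₂ 0) ≠ Circle.exp (p w₂ 1))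
    (hreg : ∀ w, w ≠ w₁ → w ≠ w₂ → w ∉ S → Function.Injective fun i : Fin 3 => Circle.exp (p w i)) (hregS : ∀ w, w ∈ S → p w 0 ≠ 0)
    {C' : Set ↥(arch (↥(maximalRealSubfield L)) L (IsCMField.complexConj L) 3 (Matrix.diagonal α))} (hC' : IsCompact C') :
    ∃ (C'' : Set ↥(arch (↥(maximalRealSubfield L)) L (IsCMField.complexConj L) 3 (Matrix.diagonal α))) (U : Set ({w : InfinitePlace L // IsComplex w} → Fin 3 → ℝ)),
      IsCompact C'' ∧ IsOpen U ∧ p ∈ U ∧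
      (∀ c ∈ U, ∀ w, w ∉ S → w ≠ w₁ → w ≠ w₂ → Function.Injective fun l : Fin 3 => Circle.exp (c w l)) ∧ (∀ c ∈ U, ∀ w ∈ S, c w 0 ≠ 0) ∧
      ∀ c ∈ U, ∀ y' : ↥(arch (↥(maximalRealSubfield L)) L (IsCMField.complexConj L) 3 (Matrix.diagonal α)), y' * gprimeTorus L α S c * y'⁻¹ ∈ C' → y' ∈ C'' * ((Subgroup.centralizer ({gprimeTorus L α S p} : Set ↥(arch (↥(maximalRealSubfield L)) L (IsCMField.complexConj L) 3 (Matrix.diagonal α)))) : Set ↥(arch (↥(maximalRealSubfield L)) L (IsCMField.complexConj L) 3 (Matrix.diagonal α))) := by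
  have hkey : ∀ (w : {w : InfinitePlace L // IsComplex w}), p w 0 = p w 2 → ∀ j : Fin 3, j ≠ 1 → Circle.exp (p w j) = Circle.exp (p w 0) := by
    intro w h j hj
    fin_cases j
    · rfl
    · exact absurd rfl hj
    · exact congrArg Circle.exp h.symm
  have hwall : ∀ (w : {w : InfinitePlace L // IsComplex w}), p w 0 = p w 2 → ∀ j j' : Fin 3, j ≠ 1 → j' ≠ 1 → Circle.exp (p w j) = Circle.exp (p w j') :=
    fun w h j j' hj hj' => (hkey w h j hj).trans (hkey w h j' hj').symm
  -- `p` lies in the (open) two-wall box; take a closed ball inside it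
  have hpbox : p ∈ Set.pi Set.univ (fun w : {w : InfinitePlace L // IsComplex w} => {cw : Fin 3 → ℝ |
        ((w = w₁ ∨ w = w₂) → ∀ j : Fin 3, j ≠ 1 → Circle.exp (cw 1) ≠ Circle.exp (cw j)) ∧
        (w ∉ S → w ≠ w₁ → w ≠ w₂ → Function.Injective fun l : Fin 3 => Circle.exp (cw l)) ∧ (w ∈ S → cw 0 ≠ 0)}) := by
    intro w _
    refine ⟨fun hw j hj => ?_, fun hwS h1 h2 => hreg w h1 h2 hwS, fun hwS => hregS w hwS⟩
    rcases hw with rfl | rfl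
    · rw [hkey _ h02₁ j hj]; exact fun h => h01₁ h.symm
    · rw [hkey _ h02₂ j hj]; exact fun h => h01₂ h.symm
  obtain ⟨ε, hε, hball⟩ := Metric.isOpen_iff.1 (isOpen_pi_twoWallBox S w₁ w₂) p hpbox
  have hKc : IsCompact (Metric.closedBall p (ε / 2)) := isCompact_closedBall p (ε / 2)
  have hKU : Metric.closedBall p (ε / 2) ⊆ Set.pi Set.univ (fun w : {w : InfinitePlace L // IsComplex w} => {cw : Fin 3 → ℝ |
        ((w = w₁ ∨ w = w₂) → ∀ j : Fin 3, j ≠ 1 → Circle.exp (cw 1) ≠ Circle.exp (cw j)) ∧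
        (w ∉ S → w ≠ w₁ → w ≠ w₂ → Function.Injective fun l : Fin 3 => Circle.exp (cw l)) ∧ (w ∈ S → cw 0 ≠ 0)}) := (Metric.closedBall_subset_ball (by linarith)).trans hball
  have hw₁' : ¬ (w₁ ∈ S ∧ w₁ ∈ splitChartPlaces L α) := fun h => hw₁ h.1
  have hw₂' : ¬ (w₂ ∈ S ∧ w₂ ∈ splitChartPlaces L α) := fun h => hw₂ h.1
  have hpS : ∀ w, w ∈ S ∧ w ∈ splitChartPlaces L α → p w 0 ≠ 0 := fun w hw => hregS w hw.1
  obtain ⟨𝒦', h𝒦', hmem𝒦⟩ := uniformlyProper_gprimeTorus_of_twoWall L α S w₁ w₂ p hα hreal hw₁' hw₂' (hwall w₁ h02₁) (hwall w₂ h02₂) hpS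
    (fun w : {w : InfinitePlace L // IsComplex w} => {cw : Fin 3 → ℝ |
        ((w = w₁ ∨ w = w₂) → ∀ j : Fin 3, j ≠ 1 → Circle.exp (cw 1) ≠ Circle.exp (cw j)) ∧
        (w ∉ S → w ≠ w₁ → w ≠ w₂ → Function.Injective fun l : Fin 3 => Circle.exp (cw l)) ∧ (w ∈ S → cw 0 ≠ 0)})
    (fun cw hcw => hcw.1 (Or.inl rfl)) (fun cw hcw => hcw.1 (Or.inr rfl))
    (fun w h1 h2 hws cw hcw => hcw.2.1 (fun hwS => hws ⟨hwS, hS w hwS⟩) h1 h2) (fun w hws cw hcw => hcw.2.2 hws.1)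
    _ hKU hKc C' hC'
  obtain ⟨C'', hC'', hsub⟩ := exists_isCompact_image_mk_superset (Subgroup.centralizer ({gprimeTorus L α S p} : Set ↥(arch (↥(maximalRealSubfield L)) L (IsCMField.complexConj L) 3 (Matrix.diagonal α)))) h𝒦'
  refine ⟨C'', Metric.ball p (ε / 2), hC'', Metric.isOpen_ball, Metric.mem_ball_self (half_pos hε),
    fun c hc w hw h1 h2 => (hKU (Metric.ball_subset_closedBall hc) w (Set.mem_univ _)).2.1 hw h1 h2,
    fun c hc w hw => (hKU (Metric.ball_subset_closedBall hc) w (Set.mem_univ _)).2.2 hw, ?_⟩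
  intro c hc y' hy'
  obtain ⟨a, ha, hay⟩ := hsub (hmem𝒦 _ (Metric.ball_subset_closedBall hc) y' hy')
  rw [QuotientGroup.eq] at hay
  exact ⟨a, ha, a⁻¹ * y', hay, by group⟩

end Box

/-! ## §2 The descent identity on the box, with a jointly smooth family of two-block test functions -/

section Chart

variable (L : Type) [Field L] [NumberField L] [IsCMField L] (α : Fin 3 → L)
  [MeasurableSpace ↥(arch (↥(maximalRealSubfield L)) L (IsCMField.complexConj L) 3 (Matrix.diagonal α))]
  [BorelSpace ↥(arch (↥(maximalRealSubfield L)) L (IsCMField.complexConj L) 3 (Matrix.diagonal α))]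
  (ν' : Measure ↥(arch (↥(maximalRealSubfield L)) L (IsCMField.complexConj L) 3 (Matrix.diagonal α))) [ν'.IsHaarMeasure] [ν'.IsMulRightInvariant]

set_option maxHeartbeats 2400000 in
/-- **(X2) TWO-BLOCK DESCENT BOX.**  House frame, admissible compact chart `S`, covered split-chart places `w₁ ≠ w₂ ∉ S`, a point `p` with walls `p_{w_i,0} = p_{w_i,2}`,
`e^{ip_{w_i,0}} ≠ e^{ip_{w_i,1}}` at `w₁`, `w₂`, regular at every other place, `a′ ∈ C_c^∞(G′_∞)`, any Haar `μ₀` on `U(J)`: there are `K ≠ 0`, an open `U ∋ p` and a JOINTLY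
SMOOTH family `f : (coordinates) × (M₂(ℂ) × M₂(ℂ)) → ℂ`, compactly supported in the matrix variables uniformly in `c` and depending on `c` only through the double tangential point
`update (update c w₁ (0, c_{w₁1}, 0)) w₂ (0, c_{w₂1}, 0)`, such that for every `c ∈ U ∩ RegG S`
**`chartOrbG L α ν′ S a′ c = K · ∫_{U(J) × U(J)} f(c, ↑↑(q₁ · P diag(e^{i c_{w₁0}}, e^{i c_{w₁2}}) P⁻¹ · q₁⁻¹), ↑↑(q₂ · P diag(e^{i c_{w₂0}}, e^{i c_{w₂2}}) P⁻¹ · q₂⁻¹)) d(μ₀ ⊗ μ₀)(q)`**.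
[cite: Rogawski1990, §4.12 Lemma 4.12.1 p. 66; §8.2 pp. 119–124] [cite: HarishChandra1970, Part I §3 Lemma 22] [cite: Shelstad1979, §4 Lemma 4.3 (p. 25)] [cite: Folland1995, §2.6 (2.52)] -/
theorem exists_descent_twoBlock_box_chartOrbG (hα : ∀ i, α i ≠ 0)
    (hreal : ∀ (w : {w : InfinitePlace L // IsComplex w}) (i : Fin 3), (w.1.embedding (α i)).im = 0)
    {J : Matrix (Fin 2) (Fin 2) ℂ} (hJ : J = (StdForm.antidiagonal 2).over ℂ)
    [MeasurableSpace ↥(unitaryGroupOfForm (starRingEnd ℂ) J)] [BorelSpace ↥(unitaryGroupOfForm (starRingEnd ℂ) J)]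
    [LocallyCompactSpace ↥(unitaryGroupOfForm (starRingEnd ℂ) J)] [SecondCountableTopology ↥(unitaryGroupOfForm (starRingEnd ℂ) J)]
    (μ₀ : Measure ↥(unitaryGroupOfForm (starRingEnd ℂ) J)) [μ₀.IsHaarMeasure] [μ₀.IsMulRightInvariant]
    {S : Finset {w : InfinitePlace L // IsComplex w}} {w₁ w₂ : {w : InfinitePlace L // IsComplex w}} {p : {w : InfinitePlace L // IsComplex w} → Fin 3 → ℝ}
    (hS : ∀ w, w ∈ S → w ∈ splitChartPlaces L α) (hw₁ : w₁ ∉ S) (hw₂ : w₂ ∉ S) (h12 : w₁ ≠ w₂)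
    (hw₁sp : w₁ ∈ splitChartPlaces L α) (hw₂sp : w₂ ∈ splitChartPlaces L α)
    (h02₁ : p w₁ 0 = p w₁ 2) (h01₁ : Circle.exp (p w₁ 0) ≠ Circle.exp (p w₁ 1))
    (h02₂ : p w₂ 0 = p w₂ 2) (h01₂ : Circle.exp (p w₂ 0) ≠ Circle.exp (p w₂ 1))
    (hreg : ∀ w, w ≠ w₁ → w ≠ w₂ → w ∉ S → Function.Injective fun i : Fin 3 => Circle.exp (p w i)) (hregS : ∀ w, w ∈ S → p w 0 ≠ 0)
    {a' : ↥(arch (↥(maximalRealSubfield L)) L (IsCMField.complexConj L) 3 (Matrix.diagonal α)) → ℂ} (ha' : ArchSmooth L 3 (Matrix.diagonal α) a') :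
    ∃ (K : ℂ) (U : Set ({w : InfinitePlace L // IsComplex w} → Fin 3 → ℝ)) (f : ({w : InfinitePlace L // IsComplex w} → Fin 3 → ℝ) × (Matrix (Fin 2) (Fin 2) ℂ × Matrix (Fin 2) (Fin 2) ℂ) → ℂ),
      K ≠ 0 ∧ IsOpen U ∧ p ∈ U ∧ ContDiff ℝ ∞ f ∧
      (∃ C : Set (Matrix (Fin 2) (Fin 2) ℂ × Matrix (Fin 2) (Fin 2) ℂ), IsCompact C ∧ ∀ c XY, XY ∉ C → f (c, XY) = 0) ∧
      (∀ c XY, f (c, XY) = f (Function.update (Function.update c w₁ ![0, c w₁ 1, 0]) w₂ ![0, c w₂ 1, 0], XY)) ∧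
      ∀ c ∈ U ∩ RegG S, chartOrbG L α ν' S a' c =
        K * ∫ q : ↥(unitaryGroupOfForm (starRingEnd ℂ) J) × ↥(unitaryGroupOfForm (starRingEnd ℂ) J),
          f (c, ((((q.1 * (⟨Matrix.GeneralLinearGroup.mkOfDetNeZero !![(1 : ℂ), 1; 1, -1] det_cayleyTwo_ne_zero *
              circleDiagonal 2 ![Circle.exp (c w₁ 0), Circle.exp (c w₁ 2)] * (Matrix.GeneralLinearGroup.mkOfDetNeZero !![(1 : ℂ), 1; 1, -1] det_cayleyTwo_ne_zero)⁻¹,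
            cayley_conj_circleDiagonal_mem_of_eq_over hJ _⟩ : ↥(unitaryGroupOfForm (starRingEnd ℂ) J)) * q.1⁻¹ : ↥(unitaryGroupOfForm (starRingEnd ℂ) J)) : GL (Fin 2) ℂ) : Matrix (Fin 2) (Fin 2) ℂ),
                 (((q.2 * (⟨Matrix.GeneralLinearGroup.mkOfDetNeZero !![(1 : ℂ), 1; 1, -1] det_cayleyTwo_ne_zero *
              circleDiagonal 2 ![Circle.exp (c w₂ 0), Circle.exp (c w₂ 2)] * (Matrix.GeneralLinearGroup.mkOfDetNeZero !![(1 : ℂ), 1; 1, -1] det_cayleyTwo_ne_zero)⁻¹,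
            cayley_conj_circleDiagonal_mem_of_eq_over hJ _⟩ : ↥(unitaryGroupOfForm (starRingEnd ℂ) J)) * q.2⁻¹ : ↥(unitaryGroupOfForm (starRingEnd ℂ) J)) : GL (Fin 2) ℂ) : Matrix (Fin 2) (Fin 2) ℂ))) ∂(μ₀.prod μ₀) := by
  -- ### frame facts
  have ha'c : Continuous a' := ha'.continuous
  have ha's : HasCompactSupport a' := ha'.hasCompactSupport
  obtain ⟨hreal2₁, hsgn₁⟩ := blockWeights_of_mem_splitChartPlaces L α w₁ hw₁sp
  obtain ⟨hreal2₂, hsgn₂⟩ := blockWeights_of_mem_splitChartPlaces L α w₂ hw₂sp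
  have h02c₁ : Circle.exp (p w₁ 0) = Circle.exp (p w₁ 2) := by rw [h02₁]
  have h02c₂ : Circle.exp (p w₂ 0) = Circle.exp (p w₂ 2) := by rw [h02₂]
  -- ### (X2-M): `e : Z(γ_p) ≃ₜ* (B₁ × B₂) × K` with its clauses
  refine (exists_continuousMulEquiv_centralizer_gprimeTorus_twoWall_explicit L α S w₁ w₂ hα hS hw₁ hw₂ h12 p h02c₁ h01₁ h02c₂ h01₂ hreg hregS).elim
    fun K hK => hK.elim fun e he => ?_
  obtain ⟨hKc, hKsub, hKcomm, h4, h5₁, h5₂, h6, hmapT, h8₁, h8₂, h9₁, h9₂, h10⟩ := he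
  -- ### (B-STD) at both places: `φ_i : B_i ≃ₜ* U(J)` with the torus clause and the frame matrix
  obtain ⟨φ₁, hφ₁, hval₁⟩ := exists_continuousMulEquiv_diagonal_weights_std (L := L) w₁.1.embedding ![α (lineOf (formSign L α w₁) 0), α (lineOf (formSign L α w₁) 2)] hreal2₁ hsgn₁ hJ
  obtain ⟨φ₂, hφ₂, hval₂⟩ := exists_continuousMulEquiv_diagonal_weights_std (L := L) w₂.1.embedding ![α (lineOf (formSign L α w₂) 0), α (lineOf (formSign L α w₂) 2)] hreal2₂ hsgn₂ hJ
  -- `e′ := (φ₁ × φ₂ × id) ∘ e : Z(γ_p) ≃ₜ* (U(J) × U(J)) × K`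
  let ψ : ↥(Subgroup.centralizer ({gprimeTorus L α S p} : Set ↥(arch (↥(maximalRealSubfield L)) L (IsCMField.complexConj L) 3 (Matrix.diagonal α)))) ≃* (↥(unitaryGroupOfForm (starRingEnd ℂ) J) × ↥(unitaryGroupOfForm (starRingEnd ℂ) J)) × ↥K :=
    e.toMulEquiv.trans (MulEquiv.prodCongr (MulEquiv.prodCongr φ₁.toMulEquiv φ₂.toMulEquiv) (MulEquiv.refl ↥K))
  have hψc : Continuous ψ := by
    show Continuous fun g => ((φ₁ (e g).1.1, φ₂ (e g).1.2), (e g).2)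
    exact ((φ₁.continuous.comp (continuous_fst.comp (continuous_fst.comp e.continuous))).prodMk
      (φ₂.continuous.comp (continuous_snd.comp (continuous_fst.comp e.continuous)))).prodMk (continuous_snd.comp e.continuous)
  have hψsc : Continuous ψ.symm := by
    show Continuous fun q : (↥(unitaryGroupOfForm (starRingEnd ℂ) J) × ↥(unitaryGroupOfForm (starRingEnd ℂ) J)) × ↥K => e.symm ((φ₁.symm q.1.1, φ₂.symm q.1.2), q.2)
    exact e.symm.continuous.comp (((φ₁.symm.continuous.comp (continuous_fst.comp continuous_fst)).prodMk
      (φ₂.symm.continuous.comp (continuous_snd.comp continuous_fst))).prodMk continuous_snd)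
  let e' : ↥(Subgroup.centralizer ({gprimeTorus L α S p} : Set ↥(arch (↥(maximalRealSubfield L)) L (IsCMField.complexConj L) 3 (Matrix.diagonal α)))) ≃ₜ* (↥(unitaryGroupOfForm (starRingEnd ℂ) J) × ↥(unitaryGroupOfForm (starRingEnd ℂ) J)) × ↥K := { ψ with continuous_toFun := hψc, continuous_invFun := hψsc }
  have he' : ∀ g, e' g = ((φ₁ (e g).1.1, φ₂ (e g).1.2), (e g).2) := fun _ => rfl
  have he's : ∀ q, e'.symm q = e.symm ((φ₁.symm q.1.1, φ₂.symm q.1.2), q.2) := fun _ => rfl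
  -- ### the chart torus sits inside `Z(γ_p)`; the block torus `A = φ₁(A₁) × φ₂(A₂)`
  have hT : chartTorusG L α S ≤ Subgroup.centralizer ({gprimeTorus L α S p} : Set ↥(arch (↥(maximalRealSubfield L)) L (IsCMField.complexConj L) 3 (Matrix.diagonal α))) := chartTorusG_le_centralizer L α S p
  let A : Subgroup (↥(unitaryGroupOfForm (starRingEnd ℂ) J) × ↥(unitaryGroupOfForm (starRingEnd ℂ) J)) :=
    (Subgroup.map (φ₁ : ↥(unitaryGroupOfForm (starRingEnd ℂ) ((Matrix.diagonal ![α (lineOf (formSign L α w₁) 0), α (lineOf (formSign L α w₁) 2)]).map w₁.1.embedding)) →* ↥(unitaryGroupOfForm (starRingEnd ℂ) J)) (((circleDiagonal 2).codRestrict (unitaryGroupOfForm (starRingEnd ℂ) ((Matrix.diagonal ![α (lineOf (formSign L α w₁) 0), α (lineOf (formSign L α w₁) 2)]).map w₁.1.embedding))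
      (circleDiagonal_mem_archLocal_diagonal L 2 ![α (lineOf (formSign L α w₁) 0), α (lineOf (formSign L α w₁) 2)] w₁)).range)).prod
    (Subgroup.map (φ₂ : ↥(unitaryGroupOfForm (starRingEnd ℂ) ((Matrix.diagonal ![α (lineOf (formSign L α w₂) 0), α (lineOf (formSign L α w₂) 2)]).map w₂.1.embedding)) →* ↥(unitaryGroupOfForm (starRingEnd ℂ) J)) (((circleDiagonal 2).codRestrict (unitaryGroupOfForm (starRingEnd ℂ) ((Matrix.diagonal ![α (lineOf (formSign L α w₂) 0), α (lineOf (formSign L α w₂) 2)]).map w₂.1.embedding))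
      (circleDiagonal_mem_archLocal_diagonal L 2 ![α (lineOf (formSign L α w₂) 0), α (lineOf (formSign L α w₂) 2)] w₂)).range))
  have hmemA : ∀ q : ↥(unitaryGroupOfForm (starRingEnd ℂ) J) × ↥(unitaryGroupOfForm (starRingEnd ℂ) J), q ∈ A ↔
      ((φ₁.symm q.1 : ↥(unitaryGroupOfForm (starRingEnd ℂ) ((Matrix.diagonal ![α (lineOf (formSign L α w₁) 0), α (lineOf (formSign L α w₁) 2)]).map w₁.1.embedding))) : GL (Fin 2) ℂ) ∈ Set.range (circleDiagonal 2) ∧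
      ((φ₂.symm q.2 : ↥(unitaryGroupOfForm (starRingEnd ℂ) ((Matrix.diagonal ![α (lineOf (formSign L α w₂) 0), α (lineOf (formSign L α w₂) 2)]).map w₂.1.embedding))) : GL (Fin 2) ℂ) ∈ Set.range (circleDiagonal 2) := by
    intro q
    simp only [A, Subgroup.mem_prod, Subgroup.mem_map, MonoidHom.mem_range, MonoidHom.coe_coe, MonoidHom.codRestrict_apply]
    constructor
    · rintro ⟨⟨b₁, ⟨u, rfl⟩, hb₁⟩, ⟨b₂, ⟨v, rfl⟩, hb₂⟩⟩
      refine ⟨⟨u, ?_⟩, ⟨v, ?_⟩⟩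
      · rw [← hb₁, ContinuousMulEquiv.symm_apply_apply]
      · rw [← hb₂, ContinuousMulEquiv.symm_apply_apply]
    · rintro ⟨⟨u, hu⟩, ⟨v, hv⟩⟩
      refine ⟨⟨φ₁.symm q.1, ⟨u, Subtype.ext hu⟩, φ₁.apply_symm_apply _⟩, ⟨φ₂.symm q.2, ⟨v, Subtype.ext hv⟩, φ₂.apply_symm_apply _⟩⟩
  have hTA' : ∀ g : ↥(Subgroup.centralizer ({gprimeTorus L α S p} : Set ↥(arch (↥(maximalRealSubfield L)) L (IsCMField.complexConj L) 3 (Matrix.diagonal α)))), g ∈ (chartTorusG L α S).subgroupOf (Subgroup.centralizer ({gprimeTorus L α S p} : Set ↥(arch (↥(maximalRealSubfield L)) L (IsCMField.complexConj L) 3 (Matrix.diagonal α)))) ↔ (e' g).1 ∈ A := by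
    intro g
    rw [Subgroup.mem_subgroupOf, h4 g, hmemA, he']
    simp only [ContinuousMulEquiv.symm_apply_apply]
  have hmapT' : Subgroup.map (e' : ↥(Subgroup.centralizer ({gprimeTorus L α S p} : Set ↥(arch (↥(maximalRealSubfield L)) L (IsCMField.complexConj L) 3 (Matrix.diagonal α)))) →* (↥(unitaryGroupOfForm (starRingEnd ℂ) J) × ↥(unitaryGroupOfForm (starRingEnd ℂ) J)) × ↥K) ((chartTorusG L α S).subgroupOf (Subgroup.centralizer ({gprimeTorus L α S p} : Set ↥(arch (↥(maximalRealSubfield L)) L (IsCMField.complexConj L) 3 (Matrix.diagonal α))))) = A.prod ⊤ := by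
    ext q
    simp only [Subgroup.mem_map, Subgroup.mem_prod, Subgroup.mem_top, and_true, MonoidHom.coe_coe]
    constructor
    · rintro ⟨g, hg, rfl⟩
      exact (hTA' g).1 hg
    · intro hq
      refine ⟨e'.symm q, (hTA' _).2 ?_, e'.apply_symm_apply q⟩
      rw [e'.apply_symm_apply]
      exact hq
  -- ### instances on `Z(γ_p)`, its quotient, `K`, `U(J) × U(J)`, `(U(J) × U(J)) ⧸ A`
  have hZc : IsClosed ((Subgroup.centralizer ({gprimeTorus L α S p} : Set ↥(arch (↥(maximalRealSubfield L)) L (IsCMField.complexConj L) 3 (Matrix.diagonal α)))) : Set ↥(arch (↥(maximalRealSubfield L)) L (IsCMField.complexConj L) 3 (Matrix.diagonal α))) := isClosed_centralizer_singleton_of_t2 _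
  haveI : LocallyCompactSpace ↥(Subgroup.centralizer ({gprimeTorus L α S p} : Set ↥(arch (↥(maximalRealSubfield L)) L (IsCMField.complexConj L) 3 (Matrix.diagonal α)))) := hZc.isClosedEmbedding_subtypeVal.locallyCompactSpace
  haveI : SecondCountableTopology ↥(Subgroup.centralizer ({gprimeTorus L α S p} : Set ↥(arch (↥(maximalRealSubfield L)) L (IsCMField.complexConj L) 3 (Matrix.diagonal α)))) := TopologicalSpace.Subtype.secondCountableTopology _
  letI : MeasurableSpace (↥(Subgroup.centralizer ({gprimeTorus L α S p} : Set ↥(arch (↥(maximalRealSubfield L)) L (IsCMField.complexConj L) 3 (Matrix.diagonal α)))) ⧸ (chartTorusG L α S).subgroupOf (Subgroup.centralizer ({gprimeTorus L α S p} : Set ↥(arch (↥(maximalRealSubfield L)) L (IsCMField.complexConj L) 3 (Matrix.diagonal α))))) := borel _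
  haveI : BorelSpace (↥(Subgroup.centralizer ({gprimeTorus L α S p} : Set ↥(arch (↥(maximalRealSubfield L)) L (IsCMField.complexConj L) 3 (Matrix.diagonal α)))) ⧸ (chartTorusG L α S).subgroupOf (Subgroup.centralizer ({gprimeTorus L α S p} : Set ↥(arch (↥(maximalRealSubfield L)) L (IsCMField.complexConj L) 3 (Matrix.diagonal α))))) := ⟨rfl⟩
  haveI : LocallyCompactSpace ↥K := hKc.isClosedEmbedding_subtypeVal.locallyCompactSpace
  haveI : SecondCountableTopology ↥K := TopologicalSpace.Subtype.secondCountableTopology _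
  letI : MeasurableSpace ↥K := borel _
  haveI : BorelSpace ↥K := ⟨rfl⟩
  letI : MeasurableSpace ((↥(unitaryGroupOfForm (starRingEnd ℂ) J) × ↥(unitaryGroupOfForm (starRingEnd ℂ) J)) ⧸ A) := borel _
  haveI : BorelSpace ((↥(unitaryGroupOfForm (starRingEnd ℂ) J) × ↥(unitaryGroupOfForm (starRingEnd ℂ) J)) ⧸ A) := ⟨rfl⟩
  haveI : CompactSpace ↥(Subgroup.map (φ₁ : ↥(unitaryGroupOfForm (starRingEnd ℂ) ((Matrix.diagonal ![α (lineOf (formSign L α w₁) 0), α (lineOf (formSign L α w₁) 2)]).map w₁.1.embedding)) →* ↥(unitaryGroupOfForm (starRingEnd ℂ) J)) (((circleDiagonal 2).codRestrict (unitaryGroupOfForm (starRingEnd ℂ) ((Matrix.diagonal ![α (lineOf (formSign L α w₁) 0), α (lineOf (formSign L α w₁) 2)]).map w₁.1.embedding))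
      (circleDiagonal_mem_archLocal_diagonal L 2 ![α (lineOf (formSign L α w₁) 0), α (lineOf (formSign L α w₁) 2)] w₁)).range)) :=
    isCompact_iff_compactSpace.mp (isCompact_map_circleDiagonal_range L α w₁ φ₁)
  haveI : CompactSpace ↥(Subgroup.map (φ₂ : ↥(unitaryGroupOfForm (starRingEnd ℂ) ((Matrix.diagonal ![α (lineOf (formSign L α w₂) 0), α (lineOf (formSign L α w₂) 2)]).map w₂.1.embedding)) →* ↥(unitaryGroupOfForm (starRingEnd ℂ) J)) (((circleDiagonal 2).codRestrict (unitaryGroupOfForm (starRingEnd ℂ) ((Matrix.diagonal ![α (lineOf (formSign L α w₂) 0), α (lineOf (formSign L α w₂) 2)]).map w₂.1.embedding))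
      (circleDiagonal_mem_archLocal_diagonal L 2 ![α (lineOf (formSign L α w₂) 0), α (lineOf (formSign L α w₂) 2)] w₂)).range)) :=
    isCompact_iff_compactSpace.mp (isCompact_map_circleDiagonal_range L α w₂ φ₂)
  have hAcpt : IsCompact ((A : Subgroup (↥(unitaryGroupOfForm (starRingEnd ℂ) J) × ↥(unitaryGroupOfForm (starRingEnd ℂ) J))) : Set (↥(unitaryGroupOfForm (starRingEnd ℂ) J) × ↥(unitaryGroupOfForm (starRingEnd ℂ) J))) := by
    rw [Subgroup.coe_prod]
    exact (isCompact_map_circleDiagonal_range L α w₁ φ₁).prod (isCompact_map_circleDiagonal_range L α w₂ φ₂)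
  haveI : CompactSpace ↥A := isCompact_iff_compactSpace.mp hAcpt
  have hA : IsClosed ((A : Subgroup (↥(unitaryGroupOfForm (starRingEnd ℂ) J) × ↥(unitaryGroupOfForm (starRingEnd ℂ) J))) : Set (↥(unitaryGroupOfForm (starRingEnd ℂ) J) × ↥(unitaryGroupOfForm (starRingEnd ℂ) J))) := hAcpt.isClosed
  -- `A` is commutative (both factors are images of the commutative unit-diagonal tori)
  have hcommA₁ : ∀ x y : ↥(unitaryGroupOfForm (starRingEnd ℂ) ((Matrix.diagonal ![α (lineOf (formSign L α w₁) 0), α (lineOf (formSign L α w₁) 2)]).map w₁.1.embedding)), (x : GL (Fin 2) ℂ) ∈ Set.range (circleDiagonal 2) → (y : GL (Fin 2) ℂ) ∈ Set.range (circleDiagonal 2) → x * y = y * x := by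
    rintro x y ⟨u, hu⟩ ⟨v, hv⟩
    apply Subtype.ext
    show (x : GL (Fin 2) ℂ) * y = y * x
    rw [← hu, ← hv, ← map_mul, ← map_mul, mul_comm]
  have hcommA₂ : ∀ x y : ↥(unitaryGroupOfForm (starRingEnd ℂ) ((Matrix.diagonal ![α (lineOf (formSign L α w₂) 0), α (lineOf (formSign L α w₂) 2)]).map w₂.1.embedding)), (x : GL (Fin 2) ℂ) ∈ Set.range (circleDiagonal 2) → (y : GL (Fin 2) ℂ) ∈ Set.range (circleDiagonal 2) → x * y = y * x := by
    rintro x y ⟨u, hu⟩ ⟨v, hv⟩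
    apply Subtype.ext
    show (x : GL (Fin 2) ℂ) * y = y * x
    rw [← hu, ← hv, ← map_mul, ← map_mul, mul_comm]
  have hAcomm : ∀ a b : ↥A, a * b = b * a := by
    intro a b
    obtain ⟨ha₁, ha₂⟩ := (hmemA a.1).1 a.2
    obtain ⟨hb₁, hb₂⟩ := (hmemA b.1).1 b.2
    apply Subtype.ext
    show (a : ↥(unitaryGroupOfForm (starRingEnd ℂ) J) × ↥(unitaryGroupOfForm (starRingEnd ℂ) J)) * b = b * a
    refine Prod.ext (φ₁.symm.injective ?_) (φ₂.symm.injective ?_)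
    · show φ₁.symm ((a : ↥(unitaryGroupOfForm (starRingEnd ℂ) J) × ↥(unitaryGroupOfForm (starRingEnd ℂ) J)).1 * (b : ↥(unitaryGroupOfForm (starRingEnd ℂ) J) × ↥(unitaryGroupOfForm (starRingEnd ℂ) J)).1) = φ₁.symm ((b : ↥(unitaryGroupOfForm (starRingEnd ℂ) J) × ↥(unitaryGroupOfForm (starRingEnd ℂ) J)).1 * (a : ↥(unitaryGroupOfForm (starRingEnd ℂ) J) × ↥(unitaryGroupOfForm (starRingEnd ℂ) J)).1)
      rw [map_mul, map_mul]; exact hcommA₁ _ _ ha₁ hb₁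
    · show φ₂.symm ((a : ↥(unitaryGroupOfForm (starRingEnd ℂ) J) × ↥(unitaryGroupOfForm (starRingEnd ℂ) J)).2 * (b : ↥(unitaryGroupOfForm (starRingEnd ℂ) J) × ↥(unitaryGroupOfForm (starRingEnd ℂ) J)).2) = φ₂.symm ((b : ↥(unitaryGroupOfForm (starRingEnd ℂ) J) × ↥(unitaryGroupOfForm (starRingEnd ℂ) J)).2 * (a : ↥(unitaryGroupOfForm (starRingEnd ℂ) J) × ↥(unitaryGroupOfForm (starRingEnd ℂ) J)).2)
      rw [map_mul, map_mul]; exact hcommA₂ _ _ ha₂ hb₂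
  -- ### `Ψ : Z(γ_p) ⧸ T′ ≃ₜ (U(J) × U(J)) ⧸ A` (★ (M-UNFOLD) PART 2)
  obtain ⟨Ψ, -, hΨ⟩ := exists_quotient_homeomorph_of_map_eq_prod_top ((chartTorusG L α S).subgroupOf (Subgroup.centralizer ({gprimeTorus L α S p} : Set ↥(arch (↥(maximalRealSubfield L)) L (IsCMField.complexConj L) 3 (Matrix.diagonal α))))) A e' hmapT'
  -- ### a right- and inversion-invariant Haar measure on `Z(γ_p)` (★ p850728)
  obtain ⟨νM, hνM1, hνM2, hνM3⟩ := exists_isHaarMeasure_isMulRightInvariant_isInvInvariant_centralizer_arch (↥(maximalRealSubfield L)) L (IsCMField.complexConj L) 3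
    (Matrix.diagonal α) ({gprimeTorus L α S p} : Set ↥(arch (↥(maximalRealSubfield L)) L (IsCMField.complexConj L) 3 (Matrix.diagonal α))) K hKc hKcomm e' (μ₀.prod μ₀)
  haveI := hνM1; haveI := hνM2; haveI := hνM3
  -- ### the descent scalar `κ`: `Ψ_*(νM ∕ dt′) = κ • π_* (μ₀ ⊗ μ₀)` (★ `exists_smul_map_mk_of_block_compact`)
  haveI := isHaarMeasure_chartHaarG L α S
  haveI := isInvInvariant_chartHaarG L α S
  haveI := isHaarMeasure_map_subgroupOfEquivOfLe_symm hT (chartHaarG L α S)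
  haveI := isInvInvariant_map_subgroupOfEquivOfLe_symm hT (chartHaarG L α S)
  have hTc := isClosed_subgroupOf_of_isClosed _ (Subgroup.centralizer ({gprimeTorus L α S p} : Set ↥(arch (↥(maximalRealSubfield L)) L (IsCMField.complexConj L) 3 (Matrix.diagonal α)))) (isClosed_chartTorusG L α S)
  letI : CommGroup ↥K := { (inferInstance : Group ↥K) with mul_comm := fun a b => Subtype.ext (hKcomm _ a.2 _ b.2) }
  let νK : Measure ↥K := haarMeasure (Classical.arbitrary (TopologicalSpace.PositiveCompacts ↥K))
  haveI : νK.IsInvInvariant := IsHaarMeasure.isInvInvariant_of_regular νK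
  haveI : νK.IsMulRightInvariant := isMulRightInvariant_of_isInvInvariant νK
  letI : CommGroup ↥A := { (inferInstance : Group ↥A) with mul_comm := hAcomm }
  let ρA : Measure ↥A := haarMeasure (Classical.arbitrary (TopologicalSpace.PositiveCompacts _))
  haveI : ρA.IsInvInvariant := IsHaarMeasure.isInvInvariant_of_regular ρA
  obtain ⟨κ, hκ, hmap, -⟩ := exists_smul_map_mk_of_block_compact e' ((chartTorusG L α S).subgroupOf _) hTc A hA hTA' Ψ hΨ
    (Measure.map (Subgroup.subgroupOfEquivOfLe hT).symm (chartHaarG L α S)) νM ρA (μ₀.prod μ₀) νK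
  -- ### Harish-Chandra's compactness on a box around `p` (§1) and ONE cut-off `β` (★ p850338)
  obtain ⟨CS, U, hCSc, hUo, hpU, -, -, hCM⟩ := exists_isCompact_mul_centralizer_box_twoWall L α S w₁ w₂ p hα hreal hS hw₁ hw₂ h02₁ h01₁ h02₂ h01₂ hreg hregS ha's.isCompact
  obtain ⟨β, hβc, hβs, hβ0, -, hβ1⟩ := exists_continuous_hasCompactSupport_integral_comp_mul_eq_one_pos (Subgroup.centralizer ({gprimeTorus L α S p} : Set ↥(arch (↥(maximalRealSubfield L)) L (IsCMField.complexConj L) 3 (Matrix.diagonal α)))) hZc νM (hCSc.insert 1)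
  have hβ1S : ∀ x ∈ CS, ∀ k₀ : ↥(Subgroup.centralizer ({gprimeTorus L α S p} : Set ↥(arch (↥(maximalRealSubfield L)) L (IsCMField.complexConj L) 3 (Matrix.diagonal α)))), ∫ h : ↥(Subgroup.centralizer ({gprimeTorus L α S p} : Set ↥(arch (↥(maximalRealSubfield L)) L (IsCMField.complexConj L) 3 (Matrix.diagonal α)))), β (x * (k₀ : ↥(arch (↥(maximalRealSubfield L)) L (IsCMField.complexConj L) 3 (Matrix.diagonal α))) * (h : ↥(arch (↥(maximalRealSubfield L)) L (IsCMField.complexConj L) 3 (Matrix.diagonal α)))) ∂νM = 1 :=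
    fun x hx k₀ => hβ1 x (Set.mem_insert_of_mem _ hx) k₀
  -- ### the descended function `(a′)_M^β` and its SMOOTH ambient reading (★ aM-SMOOTH, ★ eM-SMOOTH at both places, the frame matrices of `φ₁`, `φ₂`)
  have haMc : Continuous (fun m : ↥(Subgroup.centralizer ({gprimeTorus L α S p} : Set ↥(arch (↥(maximalRealSubfield L)) L (IsCMField.complexConj L) 3 (Matrix.diagonal α)))) => ∫ x, β x • a' (x * (m : ↥(arch (↥(maximalRealSubfield L)) L (IsCMField.complexConj L) 3 (Matrix.diagonal α))) * x⁻¹) ∂ν') := continuous_integral_conj_subtype ν' _ hβc hβs ha'c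
  have haMs : HasCompactSupport (fun m : ↥(Subgroup.centralizer ({gprimeTorus L α S p} : Set ↥(arch (↥(maximalRealSubfield L)) L (IsCMField.complexConj L) 3 (Matrix.diagonal α)))) => ∫ x, β x • a' (x * (m : ↥(arch (↥(maximalRealSubfield L)) L (IsCMField.complexConj L) 3 (Matrix.diagonal α))) * x⁻¹) ∂ν') := hasCompactSupport_integral_conj ν' _ hZc hβs ha's
  obtain ⟨ΘM, hΘM, haM⟩ := exists_contDiff_descended_eq L 3 (Matrix.diagonal α) ν' ha' β hβc hβs (Subgroup.centralizer ({gprimeTorus L α S p} : Set ↥(arch (↥(maximalRealSubfield L)) L (IsCMField.complexConj L) 3 (Matrix.diagonal α))))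
  obtain ⟨Λ₁, hΛ₁, hΛ₁b⟩ := exists_contDiff_coe_symm_archPiEquivCM_mulSingle_relabel_endoEmb L α w₁ (lineOf (formSign L α w₁))
  obtain ⟨Λ₂, hΛ₂, hΛ₂b⟩ := exists_contDiff_coe_symm_archPiEquivCM_mulSingle_relabel_endoEmb L α w₂ (lineOf (formSign L α w₂))
  have hΛ₁b' : ∀ b : ↥(unitaryGroupOfForm (starRingEnd ℂ) ((Matrix.diagonal ![α (lineOf (formSign L α w₁) 0), α (lineOf (formSign L α w₁) 2)]).map w₁.1.embedding)), ((((e.symm ((b, 1), 1) : ↥(Subgroup.centralizer ({gprimeTorus L α S p} : Set ↥(arch (↥(maximalRealSubfield L)) L (IsCMField.complexConj L) 3 (Matrix.diagonal α))))) : ↥(arch (↥(maximalRealSubfield L)) L (IsCMField.complexConj L) 3 (Matrix.diagonal α))) : GL (Fin 3) (mixedSpace L)) : Matrix (Fin 3) (Fin 3) (mixedSpace L)) = Λ₁ ((b : GL (Fin 2) ℂ) : Matrix (Fin 2) (Fin 2) ℂ) :=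
    fun b => by rw [h8₁ b]; exact hΛ₁b b
  have hΛ₂b' : ∀ b : ↥(unitaryGroupOfForm (starRingEnd ℂ) ((Matrix.diagonal ![α (lineOf (formSign L α w₂) 0), α (lineOf (formSign L α w₂) 2)]).map w₂.1.embedding)), ((((e.symm ((1, b), 1) : ↥(Subgroup.centralizer ({gprimeTorus L α S p} : Set ↥(arch (↥(maximalRealSubfield L)) L (IsCMField.complexConj L) 3 (Matrix.diagonal α))))) : ↥(arch (↥(maximalRealSubfield L)) L (IsCMField.complexConj L) 3 (Matrix.diagonal α))) : GL (Fin 3) (mixedSpace L)) : Matrix (Fin 3) (Fin 3) (mixedSpace L)) = Λ₂ ((b : GL (Fin 2) ℂ) : Matrix (Fin 2) (Fin 2) ℂ) :=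
    fun b => by rw [h8₂ b]; exact hΛ₂b b
  obtain ⟨M1, hM1⟩ : ∃ M1 : GL (Fin 2) ℂ, ∀ h : ↥(unitaryGroupOfForm (starRingEnd ℂ) ((Matrix.diagonal ![α (lineOf (formSign L α w₁) 0), α (lineOf (formSign L α w₁) 2)]).map w₁.1.embedding)), ((φ₁ h : ↥(unitaryGroupOfForm (starRingEnd ℂ) J)) : GL (Fin 2) ℂ) = M1 * (h : GL (Fin 2) ℂ) * M1⁻¹ :=
    ⟨_, fun h => by rw [hval₁ h, _root_.mul_inv_rev]⟩
  obtain ⟨M2, hM2⟩ : ∃ M2 : GL (Fin 2) ℂ, ∀ h : ↥(unitaryGroupOfForm (starRingEnd ℂ) ((Matrix.diagonal ![α (lineOf (formSign L α w₂) 0), α (lineOf (formSign L α w₂) 2)]).map w₂.1.embedding)), ((φ₂ h : ↥(unitaryGroupOfForm (starRingEnd ℂ) J)) : GL (Fin 2) ℂ) = M2 * (h : GL (Fin 2) ℂ) * M2⁻¹ :=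
    ⟨_, fun h => by rw [hval₂ h, _root_.mul_inv_rev]⟩
  have hφsymm₁ : ∀ u : ↥(unitaryGroupOfForm (starRingEnd ℂ) J), (((φ₁.symm u : ↥(unitaryGroupOfForm (starRingEnd ℂ) ((Matrix.diagonal ![α (lineOf (formSign L α w₁) 0), α (lineOf (formSign L α w₁) 2)]).map w₁.1.embedding))) : GL (Fin 2) ℂ) : Matrix (Fin 2) (Fin 2) ℂ) = ((M1⁻¹ : GL (Fin 2) ℂ) : Matrix (Fin 2) (Fin 2) ℂ) * ((u : GL (Fin 2) ℂ) : Matrix (Fin 2) (Fin 2) ℂ) * ((M1 : GL (Fin 2) ℂ) : Matrix (Fin 2) (Fin 2) ℂ) := fun u => by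
    have h := hM1 (φ₁.symm u)
    rw [ContinuousMulEquiv.apply_symm_apply] at h
    have h' : ((φ₁.symm u : ↥(unitaryGroupOfForm (starRingEnd ℂ) ((Matrix.diagonal ![α (lineOf (formSign L α w₁) 0), α (lineOf (formSign L α w₁) 2)]).map w₁.1.embedding))) : GL (Fin 2) ℂ) = M1⁻¹ * (u : GL (Fin 2) ℂ) * M1 := by rw [h]; group
    rw [h', Units.val_mul, Units.val_mul]
  have hφsymm₂ : ∀ u : ↥(unitaryGroupOfForm (starRingEnd ℂ) J), (((φ₂.symm u : ↥(unitaryGroupOfForm (starRingEnd ℂ) ((Matrix.diagonal ![α (lineOf (formSign L α w₂) 0), α (lineOf (formSign L α w₂) 2)]).map w₂.1.embedding))) : GL (Fin 2) ℂ) : Matrix (Fin 2) (Fin 2) ℂ) = ((M2⁻¹ : GL (Fin 2) ℂ) : Matrix (Fin 2) (Fin 2) ℂ) * ((u : GL (Fin 2) ℂ) : Matrix (Fin 2) (Fin 2) ℂ) * ((M2 : GL (Fin 2) ℂ) : Matrix (Fin 2) (Fin 2) ℂ) := fun u => by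
    have h := hM2 (φ₂.symm u)
    rw [ContinuousMulEquiv.apply_symm_apply] at h
    have h' : ((φ₂.symm u : ↥(unitaryGroupOfForm (starRingEnd ℂ) ((Matrix.diagonal ![α (lineOf (formSign L α w₂) 0), α (lineOf (formSign L α w₂) 2)]).map w₂.1.embedding))) : GL (Fin 2) ℂ) = M2⁻¹ * (u : GL (Fin 2) ℂ) * M2 := by rw [h]; group
    rw [h', Units.val_mul, Units.val_mul]
  -- `e′⁻¹((u₁, u₂), r) = e⁻¹((φ₁⁻¹ u₁, 1), 1) · e⁻¹((1, φ₂⁻¹ u₂), 1) · r` for every `r ∈ K` (clause [10])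
  have hsymm : ∀ (u₁ u₂ : ↥(unitaryGroupOfForm (starRingEnd ℂ) J)) (r : ↥K), e'.symm ((u₁, u₂), r) = e.symm ((φ₁.symm u₁, 1), 1) * e.symm ((1, φ₂.symm u₂), 1) * (r : ↥(Subgroup.centralizer ({gprimeTorus L α S p} : Set ↥(arch (↥(maximalRealSubfield L)) L (IsCMField.complexConj L) 3 (Matrix.diagonal α))))) := by
    intro u₁ u₂ r
    rw [he's]
    apply e.injective
    rw [ContinuousMulEquiv.apply_symm_apply, map_mul, map_mul, ContinuousMulEquiv.apply_symm_apply, ContinuousMulEquiv.apply_symm_apply, h10 _ r.2]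
    ext <;> simp
  -- ONE ambient cut-off `χ ≡ 1` on the common compact matrix support of all the block test functions
  have hS₀ : IsCompact ((fun u : ↥(unitaryGroupOfForm (starRingEnd ℂ) J) × ↥(unitaryGroupOfForm (starRingEnd ℂ) J) => ((((u.1 : ↥(unitaryGroupOfForm (starRingEnd ℂ) J)) : GL (Fin 2) ℂ) : Matrix (Fin 2) (Fin 2) ℂ), (((u.2 : ↥(unitaryGroupOfForm (starRingEnd ℂ) J)) : GL (Fin 2) ℂ) : Matrix (Fin 2) (Fin 2) ℂ))) ''
      (Prod.fst '' (e' '' tsupport (fun m : ↥(Subgroup.centralizer ({gprimeTorus L α S p} : Set ↥(arch (↥(maximalRealSubfield L)) L (IsCMField.complexConj L) 3 (Matrix.diagonal α)))) => ∫ x, β x • a' (x * (m : ↥(arch (↥(maximalRealSubfield L)) L (IsCMField.complexConj L) 3 (Matrix.diagonal α))) * x⁻¹) ∂ν')))) :=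
    ((haMs.isCompact.image e'.continuous).image continuous_fst).image
      ((Units.continuous_val.comp (continuous_subtype_val.comp continuous_fst)).prodMk (Units.continuous_val.comp (continuous_subtype_val.comp continuous_snd)))
  obtain ⟨χ, hχd, hχc, hχ1, -⟩ := Literature.Analysis.Calculus.exists_contDiff_hasCompactSupport_eq_one_of_isCompact hS₀
  -- the double tangential spectator is smooth
  have hupd₁ : ContDiff ℝ ∞ fun c : {w : InfinitePlace L // IsComplex w} → Fin 3 → ℝ => Function.update c w₁ (![0, c w₁ 1, 0] : Fin 3 → ℝ) := by
    refine contDiff_pi.2 fun w => ?_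
    rcases eq_or_ne w w₁ with rfl | hw
    · simp only [Function.update_self]
      refine contDiff_pi.2 fun i => ?_
      fin_cases i
      · exact contDiff_const
      · exact contDiff_apply_apply ℝ ℝ w 1
      · exact contDiff_const
    · simp only [Function.update_of_ne hw]
      exact contDiff_apply ℝ (Fin 3 → ℝ) w
  have hupd₂ : ContDiff ℝ ∞ fun c : {w : InfinitePlace L // IsComplex w} → Fin 3 → ℝ => Function.update c w₂ (![0, c w₂ 1, 0] : Fin 3 → ℝ) := by
    refine contDiff_pi.2 fun w => ?_
    rcases eq_or_ne w w₂ with rfl | hw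
    · simp only [Function.update_self]
      refine contDiff_pi.2 fun i => ?_
      fin_cases i
      · exact contDiff_const
      · exact contDiff_apply_apply ℝ ℝ w 1
      · exact contDiff_const
    · simp only [Function.update_of_ne hw]
      exact contDiff_apply ℝ (Fin 3 → ℝ) w
  have hupd : ContDiff ℝ ∞ fun c : {w : InfinitePlace L // IsComplex w} → Fin 3 → ℝ => Function.update (Function.update c w₁ (![0, c w₁ 1, 0] : Fin 3 → ℝ)) w₂ (![0, c w₂ 1, 0] : Fin 3 → ℝ) := by
    have h := hupd₂.comp hupd₁
    have hfun : (fun c : {w : InfinitePlace L // IsComplex w} → Fin 3 → ℝ => Function.update (Function.update c w₁ (![0, c w₁ 1, 0] : Fin 3 → ℝ)) w₂ (![0, c w₂ 1, 0] : Fin 3 → ℝ)) =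
        (fun c : {w : InfinitePlace L // IsComplex w} → Fin 3 → ℝ => Function.update c w₂ (![0, c w₂ 1, 0] : Fin 3 → ℝ)) ∘
          (fun c : {w : InfinitePlace L // IsComplex w} → Fin 3 → ℝ => Function.update c w₁ (![0, c w₁ 1, 0] : Fin 3 → ℝ)) := by
      funext c
      simp only [Function.comp_apply, Function.update_of_ne (Ne.symm h12)]
    rw [hfun]
    exact h
  -- the double update is idempotent (the tangential clause)
  have hupd_idem : ∀ c : {w : InfinitePlace L // IsComplex w} → Fin 3 → ℝ,
      Function.update (Function.update (Function.update (Function.update c w₁ (![0, c w₁ 1, 0] : Fin 3 → ℝ)) w₂ (![0, c w₂ 1, 0] : Fin 3 → ℝ)) w₁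
          (![0, (Function.update (Function.update c w₁ (![0, c w₁ 1, 0] : Fin 3 → ℝ)) w₂ (![0, c w₂ 1, 0] : Fin 3 → ℝ)) w₁ 1, 0] : Fin 3 → ℝ)) w₂
        (![0, (Function.update (Function.update c w₁ (![0, c w₁ 1, 0] : Fin 3 → ℝ)) w₂ (![0, c w₂ 1, 0] : Fin 3 → ℝ)) w₂ 1, 0] : Fin 3 → ℝ) = Function.update (Function.update c w₁ (![0, c w₁ 1, 0] : Fin 3 → ℝ)) w₂ (![0, c w₂ 1, 0] : Fin 3 → ℝ) := by
    intro c
    funext w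
    by_cases hw2 : w = w₂
    · rw [hw2]
      simp only [Function.update_self, Matrix.cons_val_one, Matrix.cons_val_zero]
    · by_cases hw1 : w = w₁
      · rw [hw1]
        simp only [Function.update_of_ne h12, Function.update_self, Matrix.cons_val_one, Matrix.cons_val_zero]
      · simp only [Function.update_of_ne hw1, Function.update_of_ne hw2]
  have hRρ : ContDiff ℝ ∞ fun c : {w : InfinitePlace L // IsComplex w} → Fin 3 → ℝ => (((gprimeTorus L α S (Function.update (Function.update c w₁ (![0, c w₁ 1, 0] : Fin 3 → ℝ)) w₂ (![0, c w₂ 1, 0] : Fin 3 → ℝ)) : ↥(arch (↥(maximalRealSubfield L)) L (IsCMField.complexConj L) 3 (Matrix.diagonal α))) : GL (Fin 3) (mixedSpace L)) : Matrix (Fin 3) (Fin 3) (mixedSpace L)) :=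
    (contDiff_coe_gprimeTorus L α S).comp hupd
  -- the family
  obtain ⟨f, hf⟩ : ∃ f : ({w : InfinitePlace L // IsComplex w} → Fin 3 → ℝ) × (Matrix (Fin 2) (Fin 2) ℂ × Matrix (Fin 2) (Fin 2) ℂ) → ℂ, f = fun q =>
      (χ q.2 : ℂ) * ΘM (Λ₁ (((M1⁻¹ : GL (Fin 2) ℂ) : Matrix (Fin 2) (Fin 2) ℂ) * q.2.1 * ((M1 : GL (Fin 2) ℂ) : Matrix (Fin 2) (Fin 2) ℂ)) * Λ₂ (((M2⁻¹ : GL (Fin 2) ℂ) : Matrix (Fin 2) (Fin 2) ℂ) * q.2.2 * ((M2 : GL (Fin 2) ℂ) : Matrix (Fin 2) (Fin 2) ℂ)) *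
        (((gprimeTorus L α S (Function.update (Function.update q.1 w₁ (![0, q.1 w₁ 1, 0] : Fin 3 → ℝ)) w₂ (![0, q.1 w₂ 1, 0] : Fin 3 → ℝ)) : ↥(arch (↥(maximalRealSubfield L)) L (IsCMField.complexConj L) 3 (Matrix.diagonal α))) : GL (Fin 3) (mixedSpace L)) : Matrix (Fin 3) (Fin 3) (mixedSpace L))) := ⟨_, rfl⟩
  have hfs : ContDiff ℝ ∞ f := by
    rw [hf]
    refine ((Complex.ofRealCLM.contDiff.comp ((hχd ⊤).comp contDiff_snd)).mul
      (hΘM.comp ((((hΛ₁.comp ((contDiff_const.mul (contDiff_fst.comp contDiff_snd)).mul contDiff_const)).mul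
        (hΛ₂.comp ((contDiff_const.mul (contDiff_snd.comp contDiff_snd)).mul contDiff_const))).mul (hRρ.comp contDiff_fst)))))
  -- `f (c, (↑↑u₁, ↑↑u₂)) = (a′)_M^β (e′⁻¹((u₁, u₂), r))` for every `c`, `u₁`, `u₂` and every `r ∈ K` over the double tangential point
  have hfB : ∀ (c : {w : InfinitePlace L // IsComplex w} → Fin 3 → ℝ) (u₁ u₂ : ↥(unitaryGroupOfForm (starRingEnd ℂ) J)) (r : ↥K),
      (((r : ↥(Subgroup.centralizer ({gprimeTorus L α S p} : Set ↥(arch (↥(maximalRealSubfield L)) L (IsCMField.complexConj L) 3 (Matrix.diagonal α))))) : ↥(arch (↥(maximalRealSubfield L)) L (IsCMField.complexConj L) 3 (Matrix.diagonal α))) : GL (Fin 3) (mixedSpace L)) = (gprimeTorus L α S (Function.update (Function.update c w₁ (![0, c w₁ 1, 0] : Fin 3 → ℝ)) w₂ (![0, c w₂ 1, 0] : Fin 3 → ℝ)) : GL (Fin 3) (mixedSpace L)) →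
      (fun m : ↥(Subgroup.centralizer ({gprimeTorus L α S p} : Set ↥(arch (↥(maximalRealSubfield L)) L (IsCMField.complexConj L) 3 (Matrix.diagonal α)))) => ∫ x, β x • a' (x * (m : ↥(arch (↥(maximalRealSubfield L)) L (IsCMField.complexConj L) 3 (Matrix.diagonal α))) * x⁻¹) ∂ν') (e'.symm ((u₁, u₂), r)) = f (c, (((u₁ : GL (Fin 2) ℂ) : Matrix (Fin 2) (Fin 2) ℂ), ((u₂ : GL (Fin 2) ℂ) : Matrix (Fin 2) (Fin 2) ℂ))) := by
    intro c u₁ u₂ r hr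
    have haM' := congrFun haM (e'.symm ((u₁, u₂), r))
    beta_reduce at haM'
    beta_reduce
    have hread : ΘM ((((e'.symm ((u₁, u₂), r) : ↥(Subgroup.centralizer ({gprimeTorus L α S p} : Set ↥(arch (↥(maximalRealSubfield L)) L (IsCMField.complexConj L) 3 (Matrix.diagonal α))))) : ↥(arch (↥(maximalRealSubfield L)) L (IsCMField.complexConj L) 3 (Matrix.diagonal α))) : GL (Fin 3) (mixedSpace L)) : Matrix (Fin 3) (Fin 3) (mixedSpace L)) =
        ΘM (Λ₁ (((M1⁻¹ : GL (Fin 2) ℂ) : Matrix (Fin 2) (Fin 2) ℂ) * ((u₁ : GL (Fin 2) ℂ) : Matrix (Fin 2) (Fin 2) ℂ) * ((M1 : GL (Fin 2) ℂ) : Matrix (Fin 2) (Fin 2) ℂ)) * Λ₂ (((M2⁻¹ : GL (Fin 2) ℂ) : Matrix (Fin 2) (Fin 2) ℂ) * ((u₂ : GL (Fin 2) ℂ) : Matrix (Fin 2) (Fin 2) ℂ) * ((M2 : GL (Fin 2) ℂ) : Matrix (Fin 2) (Fin 2) ℂ)) *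
          (((gprimeTorus L α S (Function.update (Function.update c w₁ (![0, c w₁ 1, 0] : Fin 3 → ℝ)) w₂ (![0, c w₂ 1, 0] : Fin 3 → ℝ)) : ↥(arch (↥(maximalRealSubfield L)) L (IsCMField.complexConj L) 3 (Matrix.diagonal α))) : GL (Fin 3) (mixedSpace L)) : Matrix (Fin 3) (Fin 3) (mixedSpace L))) := by
      rw [hsymm]
      simp only [Subgroup.coe_mul, Units.val_mul]
      rw [hΛ₁b' (φ₁.symm u₁), hΛ₂b' (φ₂.symm u₂), hφsymm₁ u₁, hφsymm₂ u₂, hr]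
    by_cases hu : (e'.symm ((u₁, u₂), r)) ∈ tsupport (fun m : ↥(Subgroup.centralizer ({gprimeTorus L α S p} : Set ↥(arch (↥(maximalRealSubfield L)) L (IsCMField.complexConj L) 3 (Matrix.diagonal α)))) => ∫ x, β x • a' (x * (m : ↥(arch (↥(maximalRealSubfield L)) L (IsCMField.complexConj L) 3 (Matrix.diagonal α))) * x⁻¹) ∂ν')
    · have hχu : χ (((u₁ : GL (Fin 2) ℂ) : Matrix (Fin 2) (Fin 2) ℂ), ((u₂ : GL (Fin 2) ℂ) : Matrix (Fin 2) (Fin 2) ℂ)) = 1 :=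
        hχ1 _ ⟨(u₁, u₂), ⟨((u₁, u₂), r), ⟨_, hu, e'.apply_symm_apply _⟩, rfl⟩, rfl⟩
      rw [hf]
      beta_reduce
      rw [hχu, Complex.ofReal_one, one_mul, haM', hread]
    · have h0 := image_eq_zero_of_notMem_tsupport hu
      beta_reduce at h0
      have h0' := h0
      rw [haM', hread] at h0'
      rw [h0, hf]
      beta_reduce
      rw [h0', mul_zero]
  -- the `K`-component over the double tangential point ([6])
  have h6' : ∀ c : {w : InfinitePlace L // IsComplex w} → Fin 3 → ℝ,
      (((((e ⟨gprimeTorus L α S c, gprimeTorus_mem_centralizer L α S p c⟩).2 : ↥K) : ↥(Subgroup.centralizer ({gprimeTorus L α S p} : Set ↥(arch (↥(maximalRealSubfield L)) L (IsCMField.complexConj L) 3 (Matrix.diagonal α))))) : ↥(arch (↥(maximalRealSubfield L)) L (IsCMField.complexConj L) 3 (Matrix.diagonal α))) : GL (Fin 3) (mixedSpace L)) = (gprimeTorus L α S (Function.update (Function.update c w₁ (![0, c w₁ 1, 0] : Fin 3 → ℝ)) w₂ (![0, c w₂ 1, 0] : Fin 3 → ℝ)) : GL (Fin 3) (mixedSpace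 L)) :=
    fun c => by rw [h6 c]
  -- ### the descent constant `K = dt′(B′)·κ ≠ 0`
  have hdtS := toReal_chartHaarG_chartBoxImgG_pos L α S hα hS
  have hK0 : (((chartHaarG L α S (chartBoxImgG L α S)).toReal : ℂ) * ((κ : ℝ) : ℂ)) ≠ 0 :=
    mul_ne_zero (Complex.ofReal_ne_zero.2 hdtS.ne') (Complex.ofReal_ne_zero.2 (NNReal.coe_ne_zero.2 hκ))
  -- ### integrability at regular chart points (★ p850485)
  letI : MeasurableSpace (↥(arch (↥(maximalRealSubfield L)) L (IsCMField.complexConj L) 3 (Matrix.diagonal α)) ⧸ chartTorusG L α S) := borel _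
  haveI : BorelSpace (↥(arch (↥(maximalRealSubfield L)) L (IsCMField.complexConj L) 3 (Matrix.diagonal α)) ⧸ chartTorusG L α S) := ⟨rfl⟩
  haveI := isMulLeftInvariant_chartHaarG L α S
  haveI := isFiniteMeasureOnCompacts_chartHaarG L α S
  haveI := isOpenPosMeasure_chartHaarG L α S
  have hq : chartQuotientMeasureG L α ν' S = quotientMeasure (chartTorusG L α S) (chartHaarG L α S) (isClosed_chartTorusG L α S) ν' := rfl
  haveI : IsFiniteMeasureOnCompacts (chartQuotientMeasureG L α ν' S) := by rw [hq]; infer_instance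
  -- ### the block reading of `γ_c` through `e′` ([5]₁ [5]₂ + (B-STD) (i) at both places)
  have hγ : ∀ c : {w : InfinitePlace L // IsComplex w} → Fin 3 → ℝ,
      e' ⟨gprimeTorus L α S c, hT (gprimeTorus_mem_chartTorusG L α S c)⟩ =
        (((⟨Matrix.GeneralLinearGroup.mkOfDetNeZero !![(1 : ℂ), 1; 1, -1] det_cayleyTwo_ne_zero * circleDiagonal 2 ![Circle.exp (c w₁ 0), Circle.exp (c w₁ 2)] * (Matrix.GeneralLinearGroup.mkOfDetNeZero !![(1 : ℂ), 1; 1, -1] det_cayleyTwo_ne_zero)⁻¹, cayley_conj_circleDiagonal_mem_of_eq_over hJ _⟩ : ↥(unitaryGroupOfForm (starRingEnd ℂ) J)),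
          (⟨Matrix.GeneralLinearGroup.mkOfDetNeZero !![(1 : ℂ), 1; 1, -1] det_cayleyTwo_ne_zero * circleDiagonal 2 ![Circle.exp (c w₂ 0), Circle.exp (c w₂ 2)] * (Matrix.GeneralLinearGroup.mkOfDetNeZero !![(1 : ℂ), 1; 1, -1] det_cayleyTwo_ne_zero)⁻¹, cayley_conj_circleDiagonal_mem_of_eq_over hJ _⟩ : ↥(unitaryGroupOfForm (starRingEnd ℂ) J))),
          (e ⟨gprimeTorus L α S c, gprimeTorus_mem_centralizer L α S p c⟩).2) := by
    intro c
    have h1 : (e ⟨gprimeTorus L α S c, gprimeTorus_mem_centralizer L α S p c⟩).1.1 =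
        ⟨circleDiagonal 2 ![Circle.exp (c w₁ 0), Circle.exp (c w₁ 2)], circleDiagonal_mem_unitaryGroupOfForm_diagonal_map_weights w₁.1.embedding ![α (lineOf (formSign L α w₁) 0), α (lineOf (formSign L α w₁) 2)] _⟩ :=
      Subtype.ext (h5₁ c)
    have h2 : (e ⟨gprimeTorus L α S c, gprimeTorus_mem_centralizer L α S p c⟩).1.2 =
        ⟨circleDiagonal 2 ![Circle.exp (c w₂ 0), Circle.exp (c w₂ 2)], circleDiagonal_mem_unitaryGroupOfForm_diagonal_map_weights w₂.1.embedding ![α (lineOf (formSign L α w₂) 0), α (lineOf (formSign L α w₂) 2)] _⟩ :=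
      Subtype.ext (h5₂ c)
    rw [he', h1, h2, hφ₁, hφ₂]
  -- ### assembling
  refine ⟨(((chartHaarG L α S (chartBoxImgG L α S)).toReal : ℂ) * ((κ : ℝ) : ℂ)), U, f, hK0, hUo, hpU, hfs, ⟨tsupport χ, hχc, fun c XY hXY => ?_⟩, fun c XY => ?_, ?_⟩
  · rw [hf]; dsimp only; rw [image_eq_zero_of_notMem_tsupport hXY, Complex.ofReal_zero, zero_mul]
  · rw [hf]; dsimp only
    rw [hupd_idem c]
  rintro c ⟨hcU, hcreg⟩
  have hint := integrable_descConj_gprimeTorus_of_regG L α S hα hS hcreg ha'c ha's (chartQuotientMeasureG L α ν' S)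
  rw [chartOrbG_eq_integral_descended_of_cutoff L α ν' S a' ha'c (gprimeTorus L α S p) νM hT hβc hβs hβ0 hβ1S c hint (hCM c hcU),
    integral_descConj_eq_smul_integral_of_block _ _ e' Ψ hΨ _ (μ₀.prod μ₀) hmap _ _ _ (hγ c) _ haMc, NNReal.smul_def, Complex.real_smul, ← mul_assoc]
  congr 1
  refine integral_congr_ae (Filter.Eventually.of_forall fun b => ?_)
  exact hfB c _ _ _ (h6' c)

set_option maxHeartbeats 800000 in
/-- **(X2), `Measure.pi` FORM** (for the `Fin m → U(J)` towers of ★ (J) `ArchCayleyTowerFubini`): the same `K`, `U`, `f` with the integral over `Fin 2 → U(J)` against `Measure.pi (fun _ => μ₀)`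
(Mathlib `measurePreserving_finTwoArrow`). [cite: Rogawski1990, §4.12 Lemma 4.12.1 p. 66; §8.2 pp. 119–124] [cite: Folland1995, §2.6 (2.52)] -/
theorem exists_descent_twoBlock_box_chartOrbG_pi (hα : ∀ i, α i ≠ 0)
    (hreal : ∀ (w : {w : InfinitePlace L // IsComplex w}) (i : Fin 3), (w.1.embedding (α i)).im = 0)
    {J : Matrix (Fin 2) (Fin 2) ℂ} (hJ : J = (StdForm.antidiagonal 2).over ℂ)
    [MeasurableSpace ↥(unitaryGroupOfForm (starRingEnd ℂ) J)] [BorelSpace ↥(unitaryGroupOfForm (starRingEnd ℂ) J)]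
    [LocallyCompactSpace ↥(unitaryGroupOfForm (starRingEnd ℂ) J)] [SecondCountableTopology ↥(unitaryGroupOfForm (starRingEnd ℂ) J)]
    (μ₀ : Measure ↥(unitaryGroupOfForm (starRingEnd ℂ) J)) [μ₀.IsHaarMeasure] [μ₀.IsMulRightInvariant]
    {S : Finset {w : InfinitePlace L // IsComplex w}} {w₁ w₂ : {w : InfinitePlace L // IsComplex w}} {p : {w : InfinitePlace L // IsComplex w} → Fin 3 → ℝ}
    (hS : ∀ w, w ∈ S → w ∈ splitChartPlaces L α) (hw₁ : w₁ ∉ S) (hw₂ : w₂ ∉ S) (h12 : w₁ ≠ w₂)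
    (hw₁sp : w₁ ∈ splitChartPlaces L α) (hw₂sp : w₂ ∈ splitChartPlaces L α)
    (h02₁ : p w₁ 0 = p w₁ 2) (h01₁ : Circle.exp (p w₁ 0) ≠ Circle.exp (p w₁ 1))
    (h02₂ : p w₂ 0 = p w₂ 2) (h01₂ : Circle.exp (p w₂ 0) ≠ Circle.exp (p w₂ 1))
    (hreg : ∀ w, w ≠ w₁ → w ≠ w₂ → w ∉ S → Function.Injective fun i : Fin 3 => Circle.exp (p w i)) (hregS : ∀ w, w ∈ S → p w 0 ≠ 0)
    {a' : ↥(arch (↥(maximalRealSubfield L)) L (IsCMField.complexConj L) 3 (Matrix.diagonal α)) → ℂ} (ha' : ArchSmooth L 3 (Matrix.diagonal α) a') :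
    ∃ (K : ℂ) (U : Set ({w : InfinitePlace L // IsComplex w} → Fin 3 → ℝ)) (f : ({w : InfinitePlace L // IsComplex w} → Fin 3 → ℝ) × (Matrix (Fin 2) (Fin 2) ℂ × Matrix (Fin 2) (Fin 2) ℂ) → ℂ),
      K ≠ 0 ∧ IsOpen U ∧ p ∈ U ∧ ContDiff ℝ ∞ f ∧
      (∃ C : Set (Matrix (Fin 2) (Fin 2) ℂ × Matrix (Fin 2) (Fin 2) ℂ), IsCompact C ∧ ∀ c XY, XY ∉ C → f (c, XY) = 0) ∧
      (∀ c XY, f (c, XY) = f (Function.update (Function.update c w₁ ![0, c w₁ 1, 0]) w₂ ![0, c w₂ 1, 0], XY)) ∧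
      ∀ c ∈ U ∩ RegG S, chartOrbG L α ν' S a' c =
        K * ∫ h : Fin 2 → ↥(unitaryGroupOfForm (starRingEnd ℂ) J),
          f (c, ((((h 0 * (⟨Matrix.GeneralLinearGroup.mkOfDetNeZero !![(1 : ℂ), 1; 1, -1] det_cayleyTwo_ne_zero *
              circleDiagonal 2 ![Circle.exp (c w₁ 0), Circle.exp (c w₁ 2)] * (Matrix.GeneralLinearGroup.mkOfDetNeZero !![(1 : ℂ), 1; 1, -1] det_cayleyTwo_ne_zero)⁻¹,
            cayley_conj_circleDiagonal_mem_of_eq_over hJ _⟩ : ↥(unitaryGroupOfForm (starRingEnd ℂ) J)) * (h 0)⁻¹ : ↥(unitaryGroupOfForm (starRingEnd ℂ) J)) : GL (Fin 2) ℂ) : Matrix (Fin 2) (Fin 2) ℂ),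
                 (((h 1 * (⟨Matrix.GeneralLinearGroup.mkOfDetNeZero !![(1 : ℂ), 1; 1, -1] det_cayleyTwo_ne_zero *
              circleDiagonal 2 ![Circle.exp (c w₂ 0), Circle.exp (c w₂ 2)] * (Matrix.GeneralLinearGroup.mkOfDetNeZero !![(1 : ℂ), 1; 1, -1] det_cayleyTwo_ne_zero)⁻¹,
            cayley_conj_circleDiagonal_mem_of_eq_over hJ _⟩ : ↥(unitaryGroupOfForm (starRingEnd ℂ) J)) * (h 1)⁻¹ : ↥(unitaryGroupOfForm (starRingEnd ℂ) J)) : GL (Fin 2) ℂ) : Matrix (Fin 2) (Fin 2) ℂ))) ∂(Measure.pi fun _ => μ₀) := by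
  obtain ⟨K, U, f, hK, hU, hpU, hf, hC, htan, hid⟩ := exists_descent_twoBlock_box_chartOrbG L α ν' hα hreal hJ μ₀ hS hw₁ hw₂ h12 hw₁sp hw₂sp
    h02₁ h01₁ h02₂ h01₂ hreg hregS ha'
  refine ⟨K, U, f, hK, hU, hpU, hf, hC, htan, fun c hc => ?_⟩
  rw [hid c hc, ← (measurePreserving_finTwoArrow μ₀).integral_comp' (f := MeasurableEquiv.finTwoArrow)]
  rfl

end Chart

end Literature.NumberTheory.Rogawski1990

end
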